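import Summits.BirchSwinnertonDyer.BirchSwinnertonDyer.Theorems.WildThreeRankOneBSDpOfHeegnerIndexCoprime
import Summits.BirchSwinnertonDyer.BirchSwinnertonDyer.Theorems.AdditiveWildRankOneTowerSurjOfKato
import Summits.BirchSwinnertonDyer.BirchSwinnertonDyer.Theses.KatoDescentPotSupersingular
import Literature.NumberTheory.EllipticCurves.BSDQuadraticDescentShaOddPartGeneralProofs
import Summits.BirchSwinnertonDyer.Rank1Residual.X11b.Three.KolyvaginLine
import HarnessLib

/-!
# W-ALL row 2·3@3 in CERTIFICATE currency WITHOUT the rank-one `Ш_an` datum and WITHOUT any Heegner-point divisibility: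
# a `3`-descent certificate on `E` (`Ш(E)[3] = 0`) + Kato on the rank-zero twist + the twist's analytic Sha ⟹ exact sockets
# ⟹ `BSD₃(E)` (route-free class theorem; cell `bsd-wall`, D-0131 (3) M-UTD, seat `bsd-wall-utd-p3` gen 3;
# `--supports stmt-BirchSwinnertonDyer-20387`)

Context. The register (cell `bsd-jet`, DESC3 / SEL3X programmes) books rank-one rows at `3` through
`Typed.bsdp_of_card_selmerGroup_eq_pow_analyticRank`: a certified `#Sel³(E) = 3^{r_an}` plus the DATUM «`Ш_an(E)` is a
`3`-unit» — for `r_an = 1` that datum is the rounded value of `L′(E,1)/(Ω·Reg·∏c/#tors²)`, not an exactly computable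
number. This file gives the road that needs NO rank-one analytic datum: the analytic side of `E` is read through
Gross–Zagier from the RANK-ZERO twist `E^{d_K}`, whose `Ш_an` IS an exact rational (modular symbols), and whose `Ш`
is bounded by Kato on the 3-adic tower (kmc g20 `missingUpperBoundAt_twist_of_towerSurj_of_katoTam`). No Jetchev, no
McCallum, no Kolyvagin divisibility, no main conjecture: the multi-carrier JET-PRODUCT rows (census: all 3 413 onto-W r1
residue JET rows have ≥ 2 Tamagawa-3 carriers) are covered as well as the single-carrier ones.

* §1 `bsdp_three_of_jetExact_of_shaTrivial_of_katoTam` — JET-exact datum (`ord₃[E(K):ℤP] = ord₃ ∏c + v₃c`), `Ш(E)[3^∞]`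
  trivial (`ord₃ #Ш(E) = 0`, the `3`-descent certificate, `Ш(E)` finite by GZK), `Ш_an(Wd)` a `3`-unit (exact rational datum):
  {GZ, Kolyvagin (rank one over `K`), GZK, modularity, GZ86 I.(7.3), Kato A161″} (named) ⟹ `BSDp W 3`.
  Proof: Kato + unit datum ⟹ `Ш(Wd)[3^∞]` trivial and `BSDp Wd 3`; Dokchitser² Lemma 4.14
  (`card_primaryComponent_sha_baseChange_quadratic_of_odd_of_finite`) ⟹ `ord₃ #Ш(E/K) = 0` ⟹ both sockets at slack
  `v₃c` ⟹ kmc g17 / gen 0 §4.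
* §2 `bsdp_three_of_indexExcess_of_shaTrivial_of_katoTam_of_wildLowerHalfRankZero` — the same with an excess `e`
  (`ord₃ I = t + v₃c + e`, `ord₃ Ш_an(Wd) = 2e`): the upper socket from the `3`-descent certificate + Kato, the lower one from
  K9's L₀ at the twist (hypothesis); ANY carrier structure.

HONEST FRAMING: certificate-style hypotheses (`hI`, `hShaE`, `hShaAnD`) are per datum; the `3`-descent certificate is a
COMPUTATION per class (the bsd-jet DESC3 engines), so in the cell's rules these theorems do NOT close W-ALL class-wide —
they are the kernel consumers of a certificate road that avoids the rank-one `Ш_an` datum and every research input on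
JET-exact rows (§1), resp. leaves only L₀ (§2). CONDITIONAL on the named facts; «beyond-print theorem»: NO. BSD is not
proved for any curve by this file. No definition, no named fact, no `sorry`.
References: [DokchitserDokchitserAnnals2010] Lemma 4.14; [Kato2004Asterisque] Thm. 14.5 (3), (12.5.2); [GrossZagier1986]
I.(6.3), I.(7.3); [JetchevSkinnerWan2017] §7.4.1; [SchaeferStoll2004] (3-descent, the engines' source).
-/

noncomputable section

open scoped Classical

set_option linter.dupNamespace false
set_option autoImplicit false

namespace Summit.BirchSwinnertonDyer.BirchSwinnertonDyer.Theorems.SchneiderFree.Exact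

open WeierstrassCurve NumberField IsDedekindDomain Field
  Literature.NumberTheory.EllipticCurves
  Literature.NumberTheory.EllipticCurves.ModularForms
  Literature.NumberTheory.EllipticCurves.Rank1Residual
  Literature.NumberTheory.EllipticCurves.Rank1Residual.Typed
  Literature.NumberTheory.EllipticCurves.KrizLi2019
  Summit.BirchSwinnertonDyer.Rank1Residual
  Summit.BirchSwinnertonDyer.Rank1Residual.Additive
  Summit.BirchSwinnertonDyer.Rank1Residual.X11b
  Summit.BirchSwinnertonDyer.Rank1Residual.X11b.Three
  Summit.BirchSwinnertonDyer.BirchSwinnertonDyer.Theorems.UniversalToricDescentWaldspurgerFlat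
  Summit.BirchSwinnertonDyer.BirchSwinnertonDyer.Theses.KatoDescentPotSupersingular

/-- **§2 (general): index excess `e`, `Ш(E)[3^∞]` trivial, `ord₃ Ш_an(E^{d_K}) = 2e`, Kato above and L₀ below the twist ⟹
`BSD₃(E)`.** For `E` (globally minimal `W`) on `ClassO6 W 3` with `r_an = 1`, `ρ_{E,3^n}` onto for every `n`, ONE Heegner
datum `(K, Dt, H, ι, P)` at level `N_E` (odd `d_K`, Heegner hypothesis, `L(E^{d_K},1) ≠ 0`, `P = y_K`), a globally minimal model
`Wd` of `E^{d_K}`, `ord₃[E(K):ℤP] = ord₃ ∏_ℓ c_ℓ + v₃(c) + e` (`hI`), `ord₃ #Ш(E) = 0` (`hShaE`: the `3`-descent certificate;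
`Ш(E)` is finite by GZK), `ord₃ Ш_an(Wd) = 2e` (`hShaAnD`): {GZ, Kolyvagin, GZK, modularity, GZ86 I.(7.3), Kato A161″}
(named) and K9's L₀ `WildLowerHalfRankZero` (hypothesis; idle when `e = 0`, see §1) give `BSDp W 3`. ANY number of
Tamagawa-3 carriers. [cite: DokchitserDokchitserAnnals2010, Lemma 4.14] [cite: Kato2004Asterisque, Thm. 14.5 (3) (p. 236)]
[cite: JetchevSkinnerWan2017, §7.4.1 (arXiv:1512.06894 p. 30)] [cite: GrossZagier1986, Thm. I.(6.3) and (7.3)] -/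
theorem bsdp_three_of_indexExcess_of_shaTrivial_of_katoTam_of_wildLowerHalfRankZero
    (hGZ : ∀ (N : ℕ) [NeZero N] (W : WeierstrassCurve ℚ) (K : Type) [Field K] [NumberField K],
      gross_zagier N W K)
    (hKo : ∀ (N : ℕ) [NeZero N] (W : WeierstrassCurve ℚ) (K : Type) [Field K] [NumberField K],
      kolyvagin N W K)
    (hGZK : rank_eq_analyticRank_of_analyticRank_le_one) (hmod : hasEntireLFunction_rat)
    (hGZ73 : GrossZagier1986_thm_I_7_3)
    (hKatoT : Kato2004.rankZero_padicValNat_sha_add_padicValNat_tamagawa_le_of_additive_potGood_of_imageContainsSL2)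
    (hL0 : WildLowerHalfRankZero)
    (W : WeierstrassCurve ℚ) [W.IsElliptic] [W.IsGloballyMinimal] [NeZero (W.conductorNorm ℤ)]
    (hO6 : ClassO6 W 3) (hρ : ∀ n : ℕ, W.HasSurjectiveModNGaloisRep (3 ^ n : ℕ)) (hr : W.analyticRank = 1)
    (K : Type) [Field K] [NumberField K]
    (Dt : ModularParametrizationData W (W.conductorNorm ℤ))
    (H : HeegnerDatum (W.conductorNorm ℤ) (NumberField.discr K)) (ι : K →+* ℂ)
    (P : (W.baseChange K).toAffine.Point) (Wd : WeierstrassCurve ℚ) [Wd.IsElliptic] [Wd.IsGloballyMinimal]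
    (hK : IsImaginaryQuadratic K) (hodd : Odd (NumberField.discr K))
    (hHH : SatisfiesHeegnerHypothesis (W.conductorNorm ℤ) K)
    (hLd : (W.quadraticTwist (NumberField.discr K : ℚ)).entireLFunction 1 ≠ 0)
    (hP : WeierstrassCurve.Affine.Point.map ι.toRatAlgHom P = heegnerPointComplex Dt H)
    (hC : ∃ C : VariableChange ℚ, C • W.quadraticTwist (NumberField.discr K : ℚ) = Wd)
    {e : ℕ} (hI : padicValNat 3 (AddSubgroup.zmultiples P).index =
      padicValNat 3 W.tamagawaProduct + padicValNat 3 Dt.c.natAbs + e)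
    (hShaE : padicValNat 3 W.shaOrder = 0)
    (hShaAnD : ∃ q : ℚ, shaAn Wd = (q : ℂ) ∧ padicValRat 3 q = 2 * e) :
    BSDp W 3 := by
  haveI : Fact (3 : ℕ).Prime := ⟨by norm_num⟩
  have hsurj : W.HasSurjectiveModNGaloisRep 3 := by simpa using hρ 1
  have h3N : 3 ∣ W.conductorNorm ℤ :=
    (W.dvd_conductorNorm_iff_not_hasGoodReductionAtPrime 3).mpr (not_good_of_addv W 3 hO6.2.1)
  have hw : ¬ 3 ∣ Units.torsionOrder K :=
    (X11b.Three.not_dvd_discr_and_not_dvd_torsionOrder_of_heegner hK hHH (by decide) h3N).2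
  -- the Heegner point is non-torsion (Gross–Zagier); `Ш(E/K)` finite (Kolyvagin)
  have hL0v : W.entireLFunction 1 = 0 := entireLFunction_one_eq_zero_of_analyticRank_eq_one hr
  obtain ⟨-, hderiv⟩ := leadingLCoeff_eq_deriv_of_analyticRank_eq_one hr
  have hLK : LDerivEK W K ≠ 0 := by
    rw [lDerivEK_eq_deriv_mul W K hmod hL0v]; exact mul_ne_zero hderiv hLd
  have hnt : ¬ IsOfFinAddOrder P :=
    (lDerivEK_ne_zero_iff_not_isOfFinAddOrder W (W.conductorNorm ℤ) K (hGZ _ W K) hK hHH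
      ⟨Dt, H, ι, hP⟩).mp hLK
  obtain ⟨-, hfinK⟩ := hKo (W.conductorNorm ℤ) W K hK hHH ⟨Dt, H, ι, hP⟩ hnt
  haveI : Finite (W.baseChange K).sha := hfinK
  -- the twist: O6, rank zero, finite `Ш`; its halves and `BSDp Wd 3`
  obtain ⟨Cd, hCd⟩ := hC
  obtain ⟨hO6d, -⟩ := classO6_twist_of_heegner W hO6 K hK hHH hodd Wd Cd hCd
  have hD0 : (NumberField.discr K : ℚ) ≠ 0 := by exact_mod_cast NumberField.discr_ne_zero K
  haveI : (W.quadraticTwist (NumberField.discr K : ℚ)).IsElliptic := W.isElliptic_quadraticTwist hD0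
  have hLd1 : Wd.entireLFunction 1 ≠ 0 := by rw [← hCd, entireLFunction_smul]; exact hLd
  have hrd : Wd.analyticRank = 0 := analyticRank_eq_zero_of_entireLFunction_one_ne_zero Wd hLd1
  have hlowd : MissingLowerBoundAt Wd 3 := hL0 Wd hrd hO6d
  have hupd : MissingUpperBoundAt Wd 3 :=
    missingUpperBoundAt_twist_of_towerSurj_of_katoTam 3 (by decide) hKatoT hGZK hmod W hO6.2.1
      hO6.padicValRat_j_nonneg hρ rfl K hK hHH Wd ⟨Cd, hCd⟩ hLd
  have hWdBSD : BSDp Wd 3 :=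
    bsdp_of_missingPPartAt Wd 3 hGZK (by rw [hrd]; exact zero_le_one) (missingPPartAt_of_lower_of_upper Wd 3 hlowd hupd)
  -- `ord₃ #Ш(Wd) = 2e` from the two halves and the datum; `ord₃ #Ш(E/K) = 0 + 2e`
  obtain ⟨-, hfinW⟩ := hGZK W (by rw [hr])
  haveI : Finite W.sha := hfinW
  obtain ⟨-, hfinWd⟩ := hGZK Wd (by rw [hrd]; exact zero_le_one)
  haveI : Finite Wd.sha := hfinWd
  have hShaD : (padicValNat 3 Wd.shaOrder : ℤ) = 2 * e := by
    obtain ⟨q, hq, hv⟩ := hShaAnD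
    obtain ⟨q', hq', hle⟩ := hlowd
    obtain ⟨q'', hq'', hge⟩ := hupd
    have hqq : q' = q := by exact_mod_cast hq'.symm.trans hq
    have hqq' : q'' = q := by exact_mod_cast hq''.symm.trans hq
    rw [hqq, hv] at hle
    rw [hqq', hv] at hge
    exact le_antisymm (by exact_mod_cast hge) (by exact_mod_cast hle)
  have hprod : Nat.card (AddCommGroup.primaryComponent (W.baseChange K).sha 3) =
      Nat.card (AddCommGroup.primaryComponent W.sha 3) * Nat.card (AddCommGroup.primaryComponent Wd.sha 3) :=
    card_primaryComponent_sha_baseChange_quadratic_of_odd_of_finite W K hK.1 Wd ⟨Cd, hCd⟩ (W.baseChange K)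
      ⟨1, one_smul _ _⟩ 3 (by decide)
  have hshaK : padicValNat 3 (W.baseChange K).shaOrder = padicValNat 3 W.shaOrder + padicValNat 3 Wd.shaOrder := by
    rw [Koly.padicValNat_shaOrder_eq (W.baseChange K) 3, Koly.padicValNat_shaOrder_eq W 3,
      Koly.padicValNat_shaOrder_eq Wd 3, hprod, padicValNat.mul (Nat.card_pos.ne') (Nat.card_pos.ne')]
  -- both sockets at slack `v₃(c)`
  have hup : Upper.IndexUpperBoundLeAt W 3 K P (padicValNat 3 Dt.c.natAbs) := by
    unfold Upper.IndexUpperBoundLeAt; omega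
  have hlo : IndexLowerBoundLeAt W 3 K P (padicValNat 3 Dt.c.natAbs) := by
    unfold IndexLowerBoundLeAt; omega
  exact (bsdp_iff_partner_bsdp_of_exactIndexManin hGZ hKo hGZK hmod hGZ73 W 3 (W.conductorNorm ℤ) K Dt H ι P Wd hr rfl
    h3N hK hodd hw hHH hLd hP ⟨Cd, hCd⟩ (by decide) hlo hup).mpr hWdBSD

/-- **§1 (JET-exact, `e = 0`): `Ш(E)[3^∞]` trivial + `Ш_an(E^{d_K})` a `3`-unit + Kato ⟹ `BSD₃(E)` — no L₀, no Jetchev, no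
McCallum, no main conjecture, any carrier structure.** Same datum as §2 with `e = 0`; K9's L₀ is NOT needed: the lower half
of the rank-zero twist is trivial when its analytic Sha is a unit. {GZ, Kolyvagin, GZK, modularity, GZ86 I.(7.3), Kato A161″}
(named) + data (`hI`, `hShaE`, `hShaAnD`) ⟹ `BSDp W 3`. The certificate road for the multi-carrier JET-PRODUCT rows (3 413
onto-W r1 residue classes) that avoids the rank-one `Ш_an` datum. [cite: DokchitserDokchitserAnnals2010, Lemma 4.14]
[cite: Kato2004Asterisque, Thm. 14.5 (3) (p. 236)] [cite: JetchevSkinnerWan2017, §7.4.1 (arXiv:1512.06894 p. 30)] -/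
theorem bsdp_three_of_jetExact_of_shaTrivial_of_katoTam
    (hGZ : ∀ (N : ℕ) [NeZero N] (W : WeierstrassCurve ℚ) (K : Type) [Field K] [NumberField K],
      gross_zagier N W K)
    (hKo : ∀ (N : ℕ) [NeZero N] (W : WeierstrassCurve ℚ) (K : Type) [Field K] [NumberField K],
      kolyvagin N W K)
    (hGZK : rank_eq_analyticRank_of_analyticRank_le_one) (hmod : hasEntireLFunction_rat)
    (hGZ73 : GrossZagier1986_thm_I_7_3)
    (hKatoT : Kato2004.rankZero_padicValNat_sha_add_padicValNat_tamagawa_le_of_additive_potGood_of_imageContainsSL2)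
    (W : WeierstrassCurve ℚ) [W.IsElliptic] [W.IsGloballyMinimal] [NeZero (W.conductorNorm ℤ)]
    (hO6 : ClassO6 W 3) (hρ : ∀ n : ℕ, W.HasSurjectiveModNGaloisRep (3 ^ n : ℕ)) (hr : W.analyticRank = 1)
    (K : Type) [Field K] [NumberField K]
    (Dt : ModularParametrizationData W (W.conductorNorm ℤ))
    (H : HeegnerDatum (W.conductorNorm ℤ) (NumberField.discr K)) (ι : K →+* ℂ)
    (P : (W.baseChange K).toAffine.Point) (Wd : WeierstrassCurve ℚ) [Wd.IsElliptic] [Wd.IsGloballyMinimal]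
    (hK : IsImaginaryQuadratic K) (hodd : Odd (NumberField.discr K))
    (hHH : SatisfiesHeegnerHypothesis (W.conductorNorm ℤ) K)
    (hLd : (W.quadraticTwist (NumberField.discr K : ℚ)).entireLFunction 1 ≠ 0)
    (hP : WeierstrassCurve.Affine.Point.map ι.toRatAlgHom P = heegnerPointComplex Dt H)
    (hC : ∃ C : VariableChange ℚ, C • W.quadraticTwist (NumberField.discr K : ℚ) = Wd)
    (hI : padicValNat 3 (AddSubgroup.zmultiples P).index = padicValNat 3 W.tamagawaProduct + padicValNat 3 Dt.c.natAbs)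
    (hShaE : padicValNat 3 W.shaOrder = 0)
    (hShaAnD : ∃ q : ℚ, shaAn Wd = (q : ℂ) ∧ padicValRat 3 q = 0) :
    BSDp W 3 := by
  -- with a unit analytic Sha the LOWER half of ANY minimal rank-zero O6 curve is trivial, so L₀ is not needed:
  -- we instantiate §2 with `e = 0` and the tautological lower half supplied curve by curve.
  haveI : Fact (3 : ℕ).Prime := ⟨by norm_num⟩
  obtain ⟨Cd, hCd⟩ := hC
  have hD0 : (NumberField.discr K : ℚ) ≠ 0 := by exact_mod_cast NumberField.discr_ne_zero K
  haveI : (W.quadraticTwist (NumberField.discr K : ℚ)).IsElliptic := W.isElliptic_quadraticTwist hD0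
  have hLd1 : Wd.entireLFunction 1 ≠ 0 := by rw [← hCd, entireLFunction_smul]; exact hLd
  have hrd : Wd.analyticRank = 0 := analyticRank_eq_zero_of_entireLFunction_one_ne_zero Wd hLd1
  obtain ⟨hO6d, -⟩ := classO6_twist_of_heegner W hO6 K hK hHH hodd Wd Cd hCd
  -- the twist's halves directly (Kato above, the unit datum below), hence `BSDp Wd 3`
  have hlowd : MissingLowerBoundAt Wd 3 := by
    obtain ⟨q, hq, hv⟩ := hShaAnD
    exact ⟨q, hq, by rw [hv]; exact_mod_cast Nat.zero_le _⟩
  have hupd : MissingUpperBoundAt Wd 3 :=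
    missingUpperBoundAt_twist_of_towerSurj_of_katoTam 3 (by decide) hKatoT hGZK hmod W hO6.2.1
      hO6.padicValRat_j_nonneg hρ rfl K hK hHH Wd ⟨Cd, hCd⟩ hLd
  have hWdBSD : BSDp Wd 3 :=
    bsdp_of_missingPPartAt Wd 3 hGZK (by rw [hrd]; exact zero_le_one) (missingPPartAt_of_lower_of_upper Wd 3 hlowd hupd)
  -- `ord₃ #Ш(Wd) = 0`, `ord₃ #Ш(E/K) = 0`, both sockets, descent
  have hsurj : W.HasSurjectiveModNGaloisRep 3 := by simpa using hρ 1
  have h3N : 3 ∣ W.conductorNorm ℤ :=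
    (W.dvd_conductorNorm_iff_not_hasGoodReductionAtPrime 3).mpr (not_good_of_addv W 3 hO6.2.1)
  have hw : ¬ 3 ∣ Units.torsionOrder K :=
    (X11b.Three.not_dvd_discr_and_not_dvd_torsionOrder_of_heegner hK hHH (by decide) h3N).2
  have hL0v : W.entireLFunction 1 = 0 := entireLFunction_one_eq_zero_of_analyticRank_eq_one hr
  obtain ⟨-, hderiv⟩ := leadingLCoeff_eq_deriv_of_analyticRank_eq_one hr
  have hLK : LDerivEK W K ≠ 0 := by
    rw [lDerivEK_eq_deriv_mul W K hmod hL0v]; exact mul_ne_zero hderiv hLd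
  have hnt : ¬ IsOfFinAddOrder P :=
    (lDerivEK_ne_zero_iff_not_isOfFinAddOrder W (W.conductorNorm ℤ) K (hGZ _ W K) hK hHH
      ⟨Dt, H, ι, hP⟩).mp hLK
  obtain ⟨-, hfinK⟩ := hKo (W.conductorNorm ℤ) W K hK hHH ⟨Dt, H, ι, hP⟩ hnt
  haveI : Finite (W.baseChange K).sha := hfinK
  obtain ⟨-, hfinW⟩ := hGZK W (by rw [hr])
  haveI : Finite W.sha := hfinW
  obtain ⟨-, hfinWd⟩ := hGZK Wd (by rw [hrd]; exact zero_le_one)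
  haveI : Finite Wd.sha := hfinWd
  have hShaD : padicValNat 3 Wd.shaOrder = 0 := by
    obtain ⟨q, hq, hv⟩ := hShaAnD
    obtain ⟨q'', hq'', hge⟩ := hupd
    have hqq' : q'' = q := by exact_mod_cast hq''.symm.trans hq
    rw [hqq', hv] at hge
    exact_mod_cast le_antisymm hge (by exact_mod_cast Nat.zero_le _)
  have hprod : Nat.card (AddCommGroup.primaryComponent (W.baseChange K).sha 3) =
      Nat.card (AddCommGroup.primaryComponent W.sha 3) * Nat.card (AddCommGroup.primaryComponent Wd.sha 3) :=
    card_primaryComponent_sha_baseChange_quadratic_of_odd_of_finite W K hK.1 Wd ⟨Cd, hCd⟩ (W.baseChange K)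
      ⟨1, one_smul _ _⟩ 3 (by decide)
  have hshaK : padicValNat 3 (W.baseChange K).shaOrder = padicValNat 3 W.shaOrder + padicValNat 3 Wd.shaOrder := by
    rw [Koly.padicValNat_shaOrder_eq (W.baseChange K) 3, Koly.padicValNat_shaOrder_eq W 3,
      Koly.padicValNat_shaOrder_eq Wd 3, hprod, padicValNat.mul (Nat.card_pos.ne') (Nat.card_pos.ne')]
  have hup : Upper.IndexUpperBoundLeAt W 3 K P (padicValNat 3 Dt.c.natAbs) := by
    unfold Upper.IndexUpperBoundLeAt; omega
  have hlo : IndexLowerBoundLeAt W 3 K P (padicValNat 3 Dt.c.natAbs) := by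
    unfold IndexLowerBoundLeAt; omega
  exact (bsdp_iff_partner_bsdp_of_exactIndexManin hGZ hKo hGZK hmod hGZ73 W 3 (W.conductorNorm ℤ) K Dt H ι P Wd hr rfl
    h3N hK hodd hw hHH hLd hP ⟨Cd, hCd⟩ (by decide) hlo hup).mpr hWdBSD

end Summit.BirchSwinnertonDyer.BirchSwinnertonDyer.Theorems.SchneiderFree.Exact

end
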